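import Mathlib
import Summits.RiemannHypothesis.RiemannHypothesis.Theses.BeurlingCrystalline

/-!
# Assembly of route `BeurlingCrystalline` (item stmt-RiemannHypothesis-22939)

The assembly item `SpectralSide → NoContinuousSpectrum → AtomicSpectrumSelfDual → ThetaRigidity →
PfPersistence.Fake1.BeurlingRigidity` is pure logic: positivity gives a spectral measure (K1), the
measure is atomic (K2), atomic spectrum forces the self-dual g-integer theta (K3), theta rigidity
(K4) gives `PrimeIdentical g m`, contradicting the hypothesis of the leaf. Written by the D-0145
ideator seat rh-idea-6 (planner); to be proposed by a typer/prover as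
`--kind proof --target Summits/RiemannHypothesis/RiemannHypothesis/Theorems/BeurlingCrystallineAssembly.lean
 --workitem stmt-RiemannHypothesis-22939`. Nothing here bears on the truth of RH.
-/

set_option linter.dupNamespace false

namespace Summit.RiemannHypothesis.RiemannHypothesis.Theorems

open Summit.RiemannHypothesis.RiemannHypothesis.Theses.BeurlingCrystalline in
/-- The assembly item of route `BeurlingCrystalline` holds (closes stmt-RiemannHypothesis-22939). -/
theorem beurlingCrystalline_assembly_holds :
    Summit.RiemannHypothesis.RiemannHypothesis.Theses.BeurlingCrystalline.Assembly := by
  intro h1 h2 h3 h4 g m hg hinj hne hpos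
  obtain ⟨μ, hμ⟩ := h1 g m hg hinj hpos
  have hat := h2 g m hg hinj μ hμ
  have hθ := h3 g m hg hinj μ hμ hat
  exact hne (h4 g m hg hinj hθ)

end Summit.RiemannHypothesis.RiemannHypothesis.Theorems
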